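import Summits.QuantumFields.YangMills.Theorems.UnitScaleTiltProp7SymAvgTwSymSlice
import Summits.QuantumFields.YangMills.Theorems.UnitScaleTiltProp7ChartSigmaT3
import HarnessLib

/-!
# Route `UnitScaleTilt`, crux K1 child «MinimiserStabilityRegPr» (stmt-QuantumFields-19200), stub EX, route (α) — **THE (20)ˢ FIBRE CLAUSE OF THE RE-BASED CHART ON `SU(2)` DATA**
# (OWNER RULING g26-№19 (α-S): the S analogue of ✓p607122 `…Prop7SymAvgTwEq137` for the SYMMETRIC slice): for printed-regular `U₀` and `e^{iX}U₀` (so the route's guarded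
# descents ARE the complexified ones) and ANY fine `SU(2)` gauge transformation `u` whose descended values at the comparison sites are the inverse symmetric accumulated frames
# `(frameTwS U₀ (iX) ·)⁻¹` (the centre clause of `NormS`, RULING №19 (1)): **`(e^{iX}U₀)^u ∈ 𝔅_k(𝔅_k, V) ⟺ ∀ c, U̿^{twS}(iX)(c) = V(c)·Ū₀(c)⁻¹`**, hence from the log chart's
# datum equation (inside the two `log` windows) and from `Chart47T3twS` + (46)-twS + the chart image — the (20)ˢ step of FILE Aˢ `hChart_of_piecesTwS`.

Cell `ym3-torus` ∕ width seat `ym-ust-20520-w5` (gen 3).  YM₃ on T³ is ladder rung R3, not the Clay problem; nothing here is a claim about the stub, the crux or the gap.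

THE PRINT.  [Balaban1985RegularSpaces] p. 81 (1.30): «(Ũ₁^{u j})_b = u(b₋)(Ũ₁ʲ)_bu⁻¹(b₊) = V_b(Ū₀ʲ)_b⁻¹»; [Balaban1985Averaging] (11) p. 19 (covariance of the averages), (87) p. 31
(centre values of the gauge transformation = inverse accumulated frames), (89)–(92) p. 31 (double bar); [Balaban1985Variational] (20) p. 281, (47)–(49) p. 285.
WHAT IS PROVED (def-free; pure bookkeeping over ✓`Prop7SymAvgTwSym`∕`…Slice`, ★w5 g0's `SU(2)`↔`GL` letters of ✓`Prop7ChartSigmaT3` and the RegPr junction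
✓`unitsField_toUField_descendTo_of_regPr`): §1 ★★`gaugeAct_mem_fibre_iff_dbarTwS_eq`; §2 ★★★`fibreClauseS_of_logChartTwS_eq_mlog`, `fibreClauseS_of_logChartTwS_eq_zero` (EX case
`U₀ ∈ 𝔅_k(V)`), ★★★`fibreClauseS_of_chart47twS` — conclusions in the shape «`∀ u`, centre clause → `gaugeAct u (emb15 U₀ (expHermField X)) ∈ fibre F ℰp n K h V`» (the witness's
(1.19)-axiality is NOT needed for membership; `NormS`∕`AvgCondPrintS` of `…Prop7SPrintDefsS` package it).  HONEST SCOPE: no estimate, no window supplied, no witness constructed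
(existence of the axial witness with these centre values = FILE Aˢ's supplier); `--supports stmt-QuantumFields-19200 --as helper`.

References: T. Bałaban, CMP 99 (1985) 75–102 [Balaban1985RegularSpaces] ((1.28)–(1.31) pp.81–82, (1.37) p.82); CMP 98 (1985) 17–51 [Balaban1985Averaging] ((11) p.19, (87)–(92) p.31);
CMP 102 (1985) 277–309 [Balaban1985Variational] ((20) p.281, (47)–(49) p.285, Prop. 3 p.289).
-/

noncomputable section

open scoped Matrix.Norms.L2Operator

namespace Summit.QuantumFields.YangMills.Theorems.Prop7SymAvgTwSymEq137

open NormedSpace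
open Literature.MathematicalPhysics.QuantumFieldTheory.Balaban1983to89
open Literature.MathematicalPhysics.QuantumFieldTheory.Balaban1983to89.T3ContinuumYM3Torus
open T3LevelShift (siteShift)
open T3PrintedRegularOrbits (sites_eq descTransf descendTo_gaugeAct)
open T3PrintedRegularMinimiser (RegPr)
open T3ConstrainedMinimiser (fibre)
open T3TiltDescent (descendTo)
open T3UnitLawDensityEML (ℰp)
open T3SectALandauChart (bgUnits emb15)
open B7Prop1Explicit (expUnit)
open B8Thm2SetupTorus (toUGauge)
open B10Eq27TorusAxialLog (unitsField toUField)
open B11Prop3Model (Dfix)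
open MatrixLog (mlog mlog_one)
open Summit.QuantumFields.YangMills.Theorems.Prop7TPrint (expHermField)
open Summit.QuantumFields.YangMills.Theorems.Prop7SymAvgGL (descendToGL)
open Summit.QuantumFields.YangMills.Theorems.Prop7SymAvgGLSmallOfRegPr (unitsField_toUField_descendTo_of_regPr bgUnits_eq)
open Summit.QuantumFields.YangMills.Theorems.Prop7SymAvgTwSym (frameTwS dbarTwS logChartTwS QTwS CmapTwS Chart47T3twS dbarTwS_def logChartTwS_apply logChartTwS_eq_QTwS_of_chart47twS)
open Summit.QuantumFields.YangMills.Theorems.Prop7SymAvgTwEq137 (eq_of_mlog_eq)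
open Summit.QuantumFields.YangMills.Theorems.Prop7ChartSigmaT3 (unitsField_toUField_gaugeAct eq_of_unitsField_toUField_eq)
open Summit.QuantumFields.YangMills.Theorems.Prop7Chart48SymUntwisted (unitsField_toUField_emb15_expHermField)

variable (F : T3Family) {n K : ℕ} (h : n ≤ K)

/-! ## §1 Fibre membership through the symmetric transversal ⟺ the double-bar value `V·Ū₀⁻¹` -/

/-- ★★ **`(e^{iX}U₀)^u ∈ 𝔅_k(𝔅_k, V) ⟺ ∀ c, U̿^{twS}(iX)(c) = V(c)·Ū₀(c)⁻¹`** for every fine `SU(2)` gauge transformation `u` whose descended values at the comparison sites are the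
inverse SYMMETRIC accumulated frames (the centre clause of `NormS`): covariance of the descent ((11): `D(W^u) = (DW)^{u↓}`), the `SU(2)`↔`GL` letters, the RegPr junction
`D♭ = D̄_GL` for the two printed-regular fields, and the group algebra of ✓`Prop7SymAvgTwSym.dbarTwS_def`.  (Print's restricted-axial `u` has `wrec⁻¹` here instead — (87) — and
yields the (T) chart's ✓`dbarTw_eq_iff_eq137cov`.) [cite: Balaban1985Averaging, (11) p.19, (87)–(92) p.31; Balaban1985RegularSpaces, (1.28)–(1.31) pp.81–82] -/
theorem gaugeAct_mem_fibre_iff_dbarTwS_eq {ε₀ ε₁ : ℝ} (hε₀ : 0 < ε₀) (hε₀' : 10 ^ 7 * (F.L : ℝ) ^ 3 * ε₀ ≤ 1)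
    (hε₁ : 0 < ε₁) (hε₁' : 10 ^ 7 * (F.L : ℝ) ^ 3 * ε₁ ≤ 1)
    {U₀ : GaugeField (F.P K) 0 (Matrix.specialUnitaryGroup (Fin 2) ℂ)} (hU₀ : RegPr F n K ε₀ U₀)
    {X : PBond (F.P K) 0 → Matrix (Fin 2) (Fin 2) ℂ} (hX : ∀ b : PBond (F.P K) 0, (X b).IsHermitian ∧ Matrix.trace (X b) = 0)
    (hU₁ : RegPr F n K ε₁ (emb15 U₀ (expHermField X))) (V : GaugeField (F.P n) 0 (Matrix.specialUnitaryGroup (Fin 2) ℂ))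
    (u : GaugeTransf (F.P K) 0 (Matrix.specialUnitaryGroup (Fin 2) ℂ))
    (hu : ∀ y : Site (F.P n) 0, Unitary.toUnits (toUGauge (F.P n) 2 (descTransf F n K h u) y) = (frameTwS F n K h U₀ (fun b => Complex.I • X b) y)⁻¹) :
    GaugeField.gaugeAct u (emb15 U₀ (expHermField X)) ∈ fibre F ℰp n K h V ↔
      ∀ c : PBond (F.P n) 0,
        dbarTwS F n K h U₀ (fun b => Complex.I • X b) c = unitsField (toUField V) c * (unitsField (toUField (descendTo F ℰp n K h U₀)) c)⁻¹ := by
  have hD₀ : descendToGL F n K h (bgUnits F K U₀) = unitsField (toUField (descendTo F ℰp n K h U₀)) := by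
    rw [bgUnits_eq]; exact (unitsField_toUField_descendTo_of_regPr F h hε₀ hε₀' hU₀).symm
  have hD₁ : descendToGL F n K h (fun b => expUnit (Complex.I • X b) * bgUnits F K U₀ b)
      = unitsField (toUField (descendTo F ℰp n K h (emb15 U₀ (expHermField X)))) := by
    rw [← unitsField_toUField_emb15_expHermField F U₀ X hX]
    exact (unitsField_toUField_descendTo_of_regPr F h hε₁ hε₁' hU₁).symm
  show descendTo F ℰp n K h (GaugeField.gaugeAct u (emb15 U₀ (expHermField X))) = V ↔ _
  rw [descendTo_gaugeAct]
  constructor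
  · intro hV c
    have hc : unitsField (toUField (GaugeField.gaugeAct (descTransf F n K h u) (descendTo F ℰp n K h (emb15 U₀ (expHermField X))))) c
        = unitsField (toUField V) c := by rw [hV]
    rw [unitsField_toUField_gaugeAct, hu, hu, inv_inv] at hc
    rw [dbarTwS_def, hD₀, hD₁, hc]
  · intro h137
    funext c
    apply eq_of_unitsField_toUField_eq
    rw [unitsField_toUField_gaugeAct, hu, hu, inv_inv]
    have hc := h137 c
    rw [dbarTwS_def, hD₀, hD₁] at hc
    exact mul_right_cancel hc

/-! ## §2 The (20)ˢ fibre clause from the log chart's datum equation, and from CHART-47-T³-twS -/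

/-- ★★★ **(20)ˢ FROM THE DATUM EQUATION**: `U₀`, `e^{iX}U₀` printed-regular, `X` Hermitian traceless, inside the two `log` windows, `logChartTwS U₀ (iX) c = log(V(c)·Ū₀(c)⁻¹)` for all `c`
⟹ for EVERY fine `SU(2)` gauge transformation `u` with the symmetric centre clause, `(e^{iX}U₀)^u ∈ 𝔅_k(𝔅_k, V)`.  (The S analogue of ✓`fibreClause_of_logChartTw_eq_mlog`, whose `u`
is print's restricted-axial one.) [cite: Balaban1985RegularSpaces, (1.31) p.82, (1.37) p.82; Balaban1985Variational, (20) p.281; Balaban1985Averaging, (87) p.31] -/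
theorem fibreClauseS_of_logChartTwS_eq_mlog {ε₀ ε₁ : ℝ} (hε₀ : 0 < ε₀) (hε₀' : 10 ^ 7 * (F.L : ℝ) ^ 3 * ε₀ ≤ 1)
    (hε₁ : 0 < ε₁) (hε₁' : 10 ^ 7 * (F.L : ℝ) ^ 3 * ε₁ ≤ 1)
    {U₀ : GaugeField (F.P K) 0 (Matrix.specialUnitaryGroup (Fin 2) ℂ)} (hU₀ : RegPr F n K ε₀ U₀)
    {X : PBond (F.P K) 0 → Matrix (Fin 2) (Fin 2) ℂ} (hX : ∀ b : PBond (F.P K) 0, (X b).IsHermitian ∧ Matrix.trace (X b) = 0)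
    (hU₁ : RegPr F n K ε₁ (emb15 U₀ (expHermField X))) (V : GaugeField (F.P n) 0 (Matrix.specialUnitaryGroup (Fin 2) ℂ))
    (hwin : ∀ c : PBond (F.P n) 0, ‖((dbarTwS F n K h U₀ (fun b => Complex.I • X b) c : (Matrix (Fin 2) (Fin 2) ℂ)ˣ) : Matrix (Fin 2) (Fin 2) ℂ) - 1‖ < 1)
    (hwinV : ∀ c : PBond (F.P n) 0,
      ‖((unitsField (toUField V) c * (unitsField (toUField (descendTo F ℰp n K h U₀)) c)⁻¹ : (Matrix (Fin 2) (Fin 2) ℂ)ˣ) : Matrix (Fin 2) (Fin 2) ℂ) - 1‖ < 1)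
    (hlog : ∀ c : PBond (F.P n) 0, logChartTwS F n K h U₀ (fun b => Complex.I • X b) c
        = mlog (((unitsField (toUField V) c * (unitsField (toUField (descendTo F ℰp n K h U₀)) c)⁻¹ : (Matrix (Fin 2) (Fin 2) ℂ)ˣ) : Matrix (Fin 2) (Fin 2) ℂ))) :
    ∀ u : GaugeTransf (F.P K) 0 (Matrix.specialUnitaryGroup (Fin 2) ℂ),
      (∀ y : Site (F.P n) 0, Unitary.toUnits (toUGauge (F.P n) 2 (descTransf F n K h u) y) = (frameTwS F n K h U₀ (fun b => Complex.I • X b) y)⁻¹) →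
        GaugeField.gaugeAct u (emb15 U₀ (expHermField X)) ∈ fibre F ℰp n K h V := by
  intro u hu
  refine (gaugeAct_mem_fibre_iff_dbarTwS_eq F h hε₀ hε₀' hε₁ hε₁' hU₀ hX hU₁ V u hu).2 fun c => ?_
  have hc := hlog c
  rw [logChartTwS_apply] at hc
  exact Units.ext (eq_of_mlog_eq (hwin c) (hwinV c) hc)

/-- ★ **THE EX-STUB CASE `U₀ ∈ 𝔅_k(V)` (`B = 0`)**: background in the fibre, `logChartTwS U₀ (iX) = 0`, the window ⟹ the (20)ˢ fibre clause for every `u` with the symmetric centre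
clause. [cite: Balaban1985RegularSpaces, (1.13) p.78, (1.37) p.82; Balaban1985Variational, (20) p.281] -/
theorem fibreClauseS_of_logChartTwS_eq_zero {ε₀ ε₁ : ℝ} (hε₀ : 0 < ε₀) (hε₀' : 10 ^ 7 * (F.L : ℝ) ^ 3 * ε₀ ≤ 1)
    (hε₁ : 0 < ε₁) (hε₁' : 10 ^ 7 * (F.L : ℝ) ^ 3 * ε₁ ≤ 1)
    {V : GaugeField (F.P n) 0 (Matrix.specialUnitaryGroup (Fin 2) ℂ)}
    {U₀ : GaugeField (F.P K) 0 (Matrix.specialUnitaryGroup (Fin 2) ℂ)} (hU₀V : U₀ ∈ fibre F ℰp n K h V) (hU₀ : RegPr F n K ε₀ U₀)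
    {X : PBond (F.P K) 0 → Matrix (Fin 2) (Fin 2) ℂ} (hX : ∀ b : PBond (F.P K) 0, (X b).IsHermitian ∧ Matrix.trace (X b) = 0)
    (hU₁ : RegPr F n K ε₁ (emb15 U₀ (expHermField X)))
    (hwin : ∀ c : PBond (F.P n) 0, ‖((dbarTwS F n K h U₀ (fun b => Complex.I • X b) c : (Matrix (Fin 2) (Fin 2) ℂ)ˣ) : Matrix (Fin 2) (Fin 2) ℂ) - 1‖ < 1)
    (hlog : logChartTwS F n K h U₀ (fun b => Complex.I • X b) = 0) :
    ∀ u : GaugeTransf (F.P K) 0 (Matrix.specialUnitaryGroup (Fin 2) ℂ),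
      (∀ y : Site (F.P n) 0, Unitary.toUnits (toUGauge (F.P n) 2 (descTransf F n K h u) y) = (frameTwS F n K h U₀ (fun b => Complex.I • X b) y)⁻¹) →
        GaugeField.gaugeAct u (emb15 U₀ (expHermField X)) ∈ fibre F ℰp n K h V := by
  have hV : descendTo F ℰp n K h U₀ = V := hU₀V
  have h1 : ∀ c : PBond (F.P n) 0, unitsField (toUField V) c * (unitsField (toUField (descendTo F ℰp n K h U₀)) c)⁻¹ = 1 := fun c => by
    rw [hV, mul_inv_cancel]
  refine fibreClauseS_of_logChartTwS_eq_mlog F h hε₀ hε₀' hε₁ hε₁' hU₀ hX hU₁ V hwin (fun c => ?_) (fun c => ?_)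
  · rw [h1 c, Units.val_one, sub_self, norm_zero]; exact one_pos
  · rw [hlog, h1 c, Units.val_one, mlog_one, Pi.zero_apply]

/-- ★★★ **(20)ˢ — THE FIBRE PART OF (CH5EL-twS) AS A THEOREM**: `Chart47T3twS … U₀ H`, (45)–(46)-twS `QTwS U₀ ∘ H = id`, a chart parameter `A′` in the `ε`-ball with `QTwS U₀ A′` = print's log datum
`log(V·Ū₀⁻¹)` and chart image `A′ − HD(A′) = iX` (`X` Hermitian traceless, `e^{iX}U₀` printed-regular), the two `log` windows ⟹ for EVERY fine `SU(2)` gauge transformation `u` with the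
symmetric centre clause, `(e^{iX}U₀)^u ∈ 𝔅_k(𝔅_k, V)` ((48)-twS ∘ §2).  This is the `AvgCondPrintS`-supplier's core (the S analogue of ✓`fibreClause_of_chart47tw`, consumed by FILE A's
`hChart_of_piecesTw` in the comb letters). [cite: Balaban1985Variational, (47)–(49) p.285, (20) p.281, Prop. 3 p.289; Balaban1985RegularSpaces, (1.31) p.82, (1.37) p.82] -/
theorem fibreClauseS_of_chart47twS {C₂ ε ε₀ ε₁ : ℝ} (hε₀ : 0 < ε₀) (hε₀' : 10 ^ 7 * (F.L : ℝ) ^ 3 * ε₀ ≤ 1)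
    (hε₁ : 0 < ε₁) (hε₁' : 10 ^ 7 * (F.L : ℝ) ^ 3 * ε₁ ≤ 1)
    {U₀ : GaugeField (F.P K) 0 (Matrix.specialUnitaryGroup (Fin 2) ℂ)} (hU₀ : RegPr F n K ε₀ U₀)
    {H : (PBond (F.P n) 0 → Matrix (Fin 2) (Fin 2) ℂ) →ₗ[ℂ] (PBond (F.P K) 0 → Matrix (Fin 2) (Fin 2) ℂ)}
    (h47 : Chart47T3twS F n K h C₂ ε U₀ H) (hQH : ∀ Y, QTwS F n K h U₀ (H Y) = Y)
    (V : GaugeField (F.P n) 0 (Matrix.specialUnitaryGroup (Fin 2) ℂ))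
    (A' : PBond (F.P K) 0 → Matrix (Fin 2) (Fin 2) ℂ) (hA' : ‖A'‖ < ε)
    (hQA' : QTwS F n K h U₀ A'
      = fun c => mlog (((unitsField (toUField V) c * (unitsField (toUField (descendTo F ℰp n K h U₀)) c)⁻¹ : (Matrix (Fin 2) (Fin 2) ℂ)ˣ) : Matrix (Fin 2) (Fin 2) ℂ)))
    {X : PBond (F.P K) 0 → Matrix (Fin 2) (Fin 2) ℂ} (hX : ∀ b : PBond (F.P K) 0, (X b).IsHermitian ∧ Matrix.trace (X b) = 0)
    (hAX : A' - H (Dfix (CmapTwS F n K h U₀) H C₂ A') = fun b => Complex.I • X b)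
    (hU₁ : RegPr F n K ε₁ (emb15 U₀ (expHermField X)))
    (hwin : ∀ c : PBond (F.P n) 0, ‖((dbarTwS F n K h U₀ (fun b => Complex.I • X b) c : (Matrix (Fin 2) (Fin 2) ℂ)ˣ) : Matrix (Fin 2) (Fin 2) ℂ) - 1‖ < 1)
    (hwinV : ∀ c : PBond (F.P n) 0,
      ‖((unitsField (toUField V) c * (unitsField (toUField (descendTo F ℰp n K h U₀)) c)⁻¹ : (Matrix (Fin 2) (Fin 2) ℂ)ˣ) : Matrix (Fin 2) (Fin 2) ℂ) - 1‖ < 1) :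
    ∀ u : GaugeTransf (F.P K) 0 (Matrix.specialUnitaryGroup (Fin 2) ℂ),
      (∀ y : Site (F.P n) 0, Unitary.toUnits (toUGauge (F.P n) 2 (descTransf F n K h u) y) = (frameTwS F n K h U₀ (fun b => Complex.I • X b) y)⁻¹) →
        GaugeField.gaugeAct u (emb15 U₀ (expHermField X)) ∈ fibre F ℰp n K h V := by
  have h48 := logChartTwS_eq_QTwS_of_chart47twS h47 hQH A' hA'
  rw [hAX, hQA'] at h48
  exact fibreClauseS_of_logChartTwS_eq_mlog F h hε₀ hε₀' hε₁ hε₁' hU₀ hX hU₁ V hwin hwinV fun c => congrFun h48 c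

end Summit.QuantumFields.YangMills.Theorems.Prop7SymAvgTwSymEq137

end
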